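import Summits.HodgeConjecture.HodgeConjecture.Theorems.K2E1bDSCellParamsDefs   -- ★ (U8 LEVEL-B §0 leaf): `tPlus`, `cKPlus`, `tMinus`, `cKMinus`, `tBox`, `cKBox` (+ ★ `IsRegularParam`, `casimirOf`, `centralOf`, ★ `acoef`, `bcoef`)
import HarnessLib

/-!
# K2 ∕ E1b unit U8 · LEVEL-B DICTIONARY, ARITHMETIC HALF — THEOREMS-SIDE LEAF `K2E1bDSCellArithmetic`: root lines, Casimir, integrality, vertices of the
# three principal series through `Π(φ(a,b,c))` (§1–§4 of `Lines/K2_E1b_GKCohomologyU21_U8c_DSCellArithmetic.lean`, VERBATIM; PROVED, no socket)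

Cell hodgecm-mathlib, Track B «K2-LIT», engine E1b; crux item h413 = stmt-HodgeConjecture-24833 (supports-only helper; closes nothing); line author K2E1b-plan (g2);
leaf re-homed by K2E4-p10 (g2) on the dealer's word 2026-09-04T00:42:43Z (2)(b) + K2E1b-r01 (g3) PRE-BOX 00:37:25Z (2) (K2-lead RULING R3 (d): a `Theorems/`
file may not import a `Cruxes/…/Lines` module, so the 23 identities the row-U8-3 carrier file `Theorems/K2E1bDSCellData.lean` uses BY NAME are re-homed
here, SAME namespace `…Cruxes.H413.K2E1bGKCohomologyU21.U8.LevelB`, statements and proofs VERBATIM from the engine line's module (commit 76719c64e04a,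
boxed PASS K2E1b-r01 (g3) 2026-09-04T00:24:51Z); U8c's ED. 2 becomes a re-export shim importing this leaf).
Theorems only (23, `ring`∕`omega`-level); no definition, no `sorry`, no axiom, no instance, no notation.

CONTENT (U8c's summary): for a parameter `a > b > c` the factorisations of ★ `acoef`∕`bcoef` along each series — hence the EXACT root lines cutting out the
cells `D_φ⁺ = [0,∞)×[0,a−b−1]`, `J_φ⁺`, `D_φ = [0,∞)×[a−c,∞)` of the `(+)`-series `V(c_K⁺, 2t⁺)`, their mirrors on the `(−)`-series, the 4-cell series —
the Casimir identity `4c_K + 2t²∕3 = casimirOf − centralOf²∕3` (★ `casimir_principalSeries` vs the tier-1 twist), the integrality `2t + 2e ∈ 6ℤ`, the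
vertex (lowest `K`-type) coordinates `D_φ (a−c+1, a+c−2b)`, `D_φ⁺ (a−b, a+b−2c+3)`, `D_φ⁻ (b−c, b+c−2a−3)`, the calibration at `φ = ρ`
(`V(−3∕2, ±6)`, `V(0,0)`), and `rootLines_in_cone` under ★ `IsRegularParam`.
(Rogawski1990, §12.3 pp. 176–177) (Kovacevic2021, §3 Thm 3; §6) (BorelWallach2000, VI §4 4.7–4.10) — arithmetic of the engine line (hence untagged).
HONEST LABEL: HC_CM is proved only modulo the 7 printed citations (2 remaining named inputs: hLiu418 = stmt-HodgeConjecture-24832, h413 =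
stmt-HodgeConjecture-24833) until rung 0 closes; nothing here is a socket and nothing closes h413.
-/

set_option autoImplicit false
set_option linter.dupNamespace false

namespace Summit.HodgeConjecture.HodgeConjecture.Cruxes.H413.K2E1bGKCohomologyU21.U8.LevelB

open Literature.RepresentationTheory.Kovacevic2021.SU21Datum.PrincipalSeries (acoef bcoef)

/-! ## §1 Root lines of the `(+)`-series: `b`-roots EXACTLY at `q = a−b−1` and `q = a−c−1`, no `a`-root on `p ≥ 0` -/

/-- `bcoef c_K⁺ t⁺ q = −(q − (a−b−1))·(q − (a−c−1))`. (Kovacevic2021, §3 Thm 3 (b90)) -/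
theorem bcoef_plus (a b c q : ℤ) :
    bcoef (cKPlus a b c) (tPlus a b c) q = -(((q : ℂ) - (a - b - 1)) * ((q : ℂ) - (a - c - 1))) := by
  simp only [bcoef, cKPlus, tPlus]; push_cast; ring

/-- `acoef c_K⁺ t⁺ p = −(p + a − b + 1)·(p + a − c + 1)`. (Kovacevic2021, §3 Thm 3 (b85)) -/
theorem acoef_plus (a b c p : ℤ) :
    acoef (cKPlus a b c) (tPlus a b c) p = -(((p : ℂ) + (a - b) + 1) * ((p : ℂ) + (a - c) + 1)) := by
  simp only [acoef, cKPlus, tPlus]; push_cast; ring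

/-- The `b`-root lines of the `(+)`-series are exactly `q = a − b − 1` and `q = a − c − 1`. (Kovacevic2021, §3 Thm 3) -/
theorem bcoef_plus_eq_zero_iff (a b c q : ℤ) :
    bcoef (cKPlus a b c) (tPlus a b c) q = 0 ↔ q = a - b - 1 ∨ q = a - c - 1 := by
  rw [bcoef_plus, neg_eq_zero, mul_eq_zero, sub_eq_zero, sub_eq_zero]
  constructor
  · rintro (h | h)
    · left; exact_mod_cast (show ((q : ℤ) : ℂ) = ((a - b - 1 : ℤ) : ℂ) by push_cast; exact h)
    · right; exact_mod_cast (show ((q : ℤ) : ℂ) = ((a - c - 1 : ℤ) : ℂ) by push_cast; exact h)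
  · rintro (rfl | rfl)
    · left; push_cast; ring
    · right; push_cast; ring

/-- No `a`-root line of the `(+)`-series on the cone (`p ≥ 0`) when `a > b` and `a > c`. (Kovacevic2021, §3 Thm 3) -/
theorem acoef_plus_ne_zero {a b c p : ℤ} (hab : b < a) (hac : c < a) (hp : 0 ≤ p) :
    acoef (cKPlus a b c) (tPlus a b c) p ≠ 0 := by
  rw [acoef_plus, neg_ne_zero, mul_ne_zero_iff]
  constructor
  · exact_mod_cast (show ((p + (a - b) + 1 : ℤ) : ℂ) ≠ 0 by exact_mod_cast (show (p + (a - b) + 1 : ℤ) ≠ 0 by omega))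
  · exact_mod_cast (show ((p + (a - c) + 1 : ℤ) : ℂ) ≠ 0 by exact_mod_cast (show (p + (a - c) + 1 : ℤ) ≠ 0 by omega))

/-! ## §2 Root lines of the `(−)`-series (mirror) and of the 4-cell series -/

/-- `acoef c_K⁻ t⁻ p = −(p − (b−c−1))·(p − (a−c−1))`. (Kovacevic2021, §3 Thm 3 (b85)) -/
theorem acoef_minus (a b c p : ℤ) :
    acoef (cKMinus a b c) (tMinus a b c) p = -(((p : ℂ) - (b - c - 1)) * ((p : ℂ) - (a - c - 1))) := by
  simp only [acoef, cKMinus, tMinus]; push_cast; ring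

/-- `bcoef c_K⁻ t⁻ q = −(q + b − c + 1)·(q + a − c + 1)`. (Kovacevic2021, §3 Thm 3 (b90)) -/
theorem bcoef_minus (a b c q : ℤ) :
    bcoef (cKMinus a b c) (tMinus a b c) q = -(((q : ℂ) + (b - c) + 1) * ((q : ℂ) + (a - c) + 1)) := by
  simp only [bcoef, cKMinus, tMinus]; push_cast; ring

/-- The `a`-root lines of the `(−)`-series are exactly `p = b − c − 1` and `p = a − c − 1`. (Kovacevic2021, §3 Thm 3) -/
theorem acoef_minus_eq_zero_iff (a b c p : ℤ) :
    acoef (cKMinus a b c) (tMinus a b c) p = 0 ↔ p = b - c - 1 ∨ p = a - c - 1 := by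
  rw [acoef_minus, neg_eq_zero, mul_eq_zero, sub_eq_zero, sub_eq_zero]
  constructor
  · rintro (h | h)
    · left; exact_mod_cast (show ((p : ℤ) : ℂ) = ((b - c - 1 : ℤ) : ℂ) by push_cast; exact h)
    · right; exact_mod_cast (show ((p : ℤ) : ℂ) = ((a - c - 1 : ℤ) : ℂ) by push_cast; exact h)
  · rintro (rfl | rfl)
    · left; push_cast; ring
    · right; push_cast; ring

/-- No `b`-root line of the `(−)`-series on the cone when `b > c` and `a > c`. (Kovacevic2021, §3 Thm 3) -/
theorem bcoef_minus_ne_zero {a b c q : ℤ} (hbc : c < b) (hac : c < a) (hq : 0 ≤ q) :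
    bcoef (cKMinus a b c) (tMinus a b c) q ≠ 0 := by
  rw [bcoef_minus, neg_ne_zero, mul_ne_zero_iff]
  constructor
  · exact_mod_cast (show ((q + (b - c) + 1 : ℤ) : ℂ) ≠ 0 by exact_mod_cast (show (q + (b - c) + 1 : ℤ) ≠ 0 by omega))
  · exact_mod_cast (show ((q + (a - c) + 1 : ℤ) : ℂ) ≠ 0 by exact_mod_cast (show (q + (a - c) + 1 : ℤ) ≠ 0 by omega))

/-- `acoef c″ t″ p = −(p − (a−b−1))·(p + b − c + 1)` (one root line `p = a−b−1` on the cone). (Kovacevic2021, §3 Thm 3 (b85)) -/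
theorem acoef_box (a b c p : ℤ) :
    acoef (cKBox a b c) (tBox a b c) p = -(((p : ℂ) - (a - b - 1)) * ((p : ℂ) + (b - c) + 1)) := by
  simp only [acoef, cKBox, tBox]; push_cast; ring

/-- `bcoef c″ t″ q = −(q − (b−c−1))·(q + a − b + 1)` (one root line `q = b−c−1` on the cone). (Kovacevic2021, §3 Thm 3 (b90)) -/
theorem bcoef_box (a b c q : ℤ) :
    bcoef (cKBox a b c) (tBox a b c) q = -(((q : ℂ) - (b - c - 1)) * ((q : ℂ) + (a - b) + 1)) := by
  simp only [bcoef, cKBox, tBox]; push_cast; ring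

/-! ## §3 Casimir and central exponent: `4c_K + 2t²∕3 = casimirOf − centralOf²∕3` on all three series; integrality `2t + 2e ∈ 6ℤ` -/

/-- Casimir of the `(+)`-series (★ `casimir_principalSeries`: `4c + 2t²∕3`) = `κ − e²∕3`. (Kovacevic2021, §3 Thm 3, Remark 3) -/
theorem casimir_plus (a b c : ℤ) :
    4 * cKPlus a b c + 2 * ((tPlus a b c : ℤ) : ℂ) ^ 2 / 3 = (casimirOf a b c : ℂ) - ((centralOf a b c : ℤ) : ℂ) ^ 2 / 3 := by
  simp only [cKPlus, tPlus, casimirOf, centralOf]; push_cast; ring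

/-- Casimir of the `(−)`-series = `κ − e²∕3`. (Kovacevic2021, §3 Thm 3, Remark 3) -/
theorem casimir_minus (a b c : ℤ) :
    4 * cKMinus a b c + 2 * ((tMinus a b c : ℤ) : ℂ) ^ 2 / 3 = (casimirOf a b c : ℂ) - ((centralOf a b c : ℤ) : ℂ) ^ 2 / 3 := by
  simp only [cKMinus, tMinus, casimirOf, centralOf]; push_cast; ring

/-- Casimir of the 4-cell series = `κ − e²∕3`. (Kovacevic2021, §3 Thm 3, Remark 3) -/
theorem casimir_box (a b c : ℤ) :
    4 * cKBox a b c + 2 * ((tBox a b c : ℤ) : ℂ) ^ 2 / 3 = (casimirOf a b c : ℂ) - ((centralOf a b c : ℤ) : ℂ) ^ 2 / 3 := by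
  simp only [cKBox, tBox, casimirOf, centralOf]; push_cast; ring

/-- Integrality of the twist on the `(+)`-series: `2t⁺ + 2e = 6a`, so `m − 3n + 3 + 2e = 2t⁺ − 6q + 2e = 6(a − q)` on its `K`-types.
(BorelWallach2000, VI §4 4.7–4.8) -/
theorem twist_integral_plus (a b c p q : ℤ) :
    (2 * tPlus a b c + 3 * p - 3 * q) - 3 * (1 + p + q) + 3 + 2 * centralOf a b c = 6 * (a - q) := by
  simp only [tPlus, centralOf]; ring

/-- Integrality on the `(−)`-series: `m − 3n + 3 + 2e = 6(c − q)`. (BorelWallach2000, VI §4 4.7–4.8) -/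
theorem twist_integral_minus (a b c p q : ℤ) :
    (2 * tMinus a b c + 3 * p - 3 * q) - 3 * (1 + p + q) + 3 + 2 * centralOf a b c = 6 * (c - q) := by
  simp only [tMinus, centralOf]; ring

/-- Integrality on the 4-cell series: `m − 3n + 3 + 2e = 6(b − q)`. (BorelWallach2000, VI §4 4.7–4.8) -/
theorem twist_integral_box (a b c p q : ℤ) :
    (2 * tBox a b c + 3 * p - 3 * q) - 3 * (1 + p + q) + 3 + 2 * centralOf a b c = 6 * (b - q) := by
  simp only [tBox, centralOf]; ring

/-! ## §4 Vertices: the lowest `K`-types of the cells, in Kovačević coordinates `(n,m) = (1+p+q, 2t+3p−3q)` -/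

/-- Vertex of the cell `D_φ = [0,∞)×[a−c,∞)` of the `(+)`-series (corner `p = 0, q = a−c`): `(n,m) = (a−c+1, a+c−2b)`.
(BorelWallach2000, VI §4 4.10) (Rogawski1990, §12.3 p. 177) -/
theorem vertex_D_plusSeries (a b c : ℤ) :
    (1 + 0 + (a - c), 2 * tPlus a b c + 3 * 0 - 3 * (a - c)) = (a - c + 1, a + c - 2 * b) := by
  simp only [tPlus, Prod.mk.injEq]; constructor <;> ring

/-- Vertex of `D_φ⁺ = [0,∞)×[0,a−b−1]` (Blattner corner `p = 0, q = a−b−1`): `(n,m) = (a−b, a+b−2c+3)`. (BorelWallach2000, VI §4 4.10) -/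
theorem vertex_Dplus (a b c : ℤ) :
    (1 + 0 + (a - b - 1), 2 * tPlus a b c + 3 * 0 - 3 * (a - b - 1)) = (a - b, a + b - 2 * c + 3) := by
  simp only [tPlus, Prod.mk.injEq]; constructor <;> ring

/-- Vertex of `D_φ⁻ = [0,b−c−1]×[0,∞)` of the `(−)`-series (corner `p = b−c−1, q = 0`): `(n,m) = (b−c, b+c−2a−3)`. (BorelWallach2000, VI §4 4.10) -/
theorem vertex_Dminus (a b c : ℤ) :
    (1 + (b - c - 1) + 0, 2 * tMinus a b c + 3 * (b - c - 1) - 3 * 0) = (b - c, b + c - 2 * a - 3) := by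
  simp only [tMinus, Prod.mk.injEq]; constructor <;> ring

/-- Vertex of `D_φ = [a−c,∞)×[0,∞)` in the `(−)`-series: the same `(a−c+1, a+c−2b)` (consistency of the two realisations). (BorelWallach2000, VI §4 4.10) -/
theorem vertex_D_minusSeries (a b c : ℤ) :
    (1 + (a - c) + 0, 2 * tMinus a b c + 3 * (a - c) - 3 * 0) = (a - c + 1, a + c - 2 * b) := by
  simp only [tMinus, Prod.mk.injEq]; constructor <;> ring

/-- Vertex of `D_φ = [a−b,∞)×[b−c,∞)` in the 4-cell series: again `(a−c+1, a+c−2b)`. (BorelWallach2000, VI §4 4.10) -/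
theorem vertex_D_boxSeries (a b c : ℤ) :
    (1 + (a - b) + (b - c), 2 * tBox a b c + 3 * (a - b) - 3 * (b - c)) = (a - c + 1, a + c - 2 * b) := by
  simp only [tBox, Prod.mk.injEq]; constructor <;> ring

/-- Calibration at the cohomological point `φ = ρ`, `(a,b,c) = (1,0,−1)`: the `(±)`-series are `V(−3∕2, ±6)` and the 4-cell series is `V(0,0)`
(★ `SU21PrincipalSeriesCompositionFactors`), with vertices `(3,0)`, `(1,6)`, `(1,−6)` = ★ `midDS`, `holDS`, `antiholDS`. (Kovacevic2021, §6) -/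
theorem calibration_rho :
    tPlus 1 0 (-1) = 3 ∧ tMinus 1 0 (-1) = -3 ∧ tBox 1 0 (-1) = 0 ∧
      cKPlus 1 0 (-1) = -3 / 2 ∧ cKMinus 1 0 (-1) = -3 / 2 ∧ cKBox 1 0 (-1) = 0 := by
  refine ⟨rfl, rfl, rfl, ?_, ?_, ?_⟩ <;> simp only [cKPlus, cKMinus, cKBox] <;> push_cast <;> norm_num

/-- Under `IsRegularParam a b c` (`m_R, n_R ≥ 2`) the three series have the root lines INSIDE the cone with non-empty cells:
`0 ≤ a−b−1 < a−c−1` and `0 ≤ b−c−1 < a−c−1`. (Rogawski1990, §12.3 p. 176) -/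
theorem rootLines_in_cone {a b c : ℤ} (h : IsRegularParam a b c) :
    0 ≤ a - b - 1 ∧ a - b - 1 < a - c - 1 ∧ 0 ≤ b - c - 1 ∧ b - c - 1 < a - c - 1 := by
  obtain ⟨h1, h2⟩ := h; omega

end Summit.HodgeConjecture.HodgeConjecture.Cruxes.H413.K2E1bGKCohomologyU21.U8.LevelB
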